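import Summits.CriticalPhenomena.PercolationContinuityZ3.Theorems.PercNearOneGluingNoHeavyLowerTailSunflowerNestedSheetPencil
import Summits.CriticalPhenomena.PercolationContinuityZ3.Theorems.PercNearOneGluingNoHeavyLowerTailSunflowerNestedSixPetalIdentities
import HarnessLib

/-!
# `NoHeavyLowerTail` (crux stmt-CriticalPhenomena-4575), abstract sunflower cubic at LAW level: (C1) ON THE SIX-PETAL NESTED PENCIL (part 4/4,
# the assembly) — hence (C1) for `[z=0: PC*(G); z=1: PC(W)]` under EVERY merging of the six petals into three

Support file (seats `prim-ineq-gen-2` gen 32 (certificates, identities) and gen 33 (this assembly); `--supports stmt-CriticalPhenomena-4575`).  Nothing is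
asserted about the crux; no `sorry`, no named facts, no definitions, standard axioms.  Memo: run/shared/lean/prim/prim-ineq-gen-2/CUBIC-SIGN-LAW-GEN32.md §2b.

SETTING (…NestedSixPetalIdentities).  Blocks `S₁,S₂,S₃`, masses `g_i, u_i, v_i ≥ 0` of `G_i`, `W_i ∖ G_i`, outside `W_i` (`G_i ⊆ W_i` up-sets, all
homogeneous).  The six-petal structure `θ⁶`: `PC*(G)` with petals `c_k` on `z = 0`, `PC(W)` with petals `d_k` on `z = 1`; its law at bias `t` of `z`:
`b = (1−t)b* + t b_P`, `c_k = (1−t)c*_k`, `d_k = t c_{P,k}`, `a = (1−t)a* + t a_P`.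
THEOREM (`nestedSix_C1`): **`e₃(c,d) ≤ max(a,b)·(ab − e₂(c,d))`** at every `t ∈ [0,1]`, all `g,u,v ≥ 0` (`e_j` = elementary symmetric functions of
the six petal masses).  Since merging petals can only decrease `e₂, e₃` of the petal vector, (C1) follows for the sunflower `[z=0: PC*(G); z=1: PC(W)]`
under every identification of the six petals into three (Theorem 4 of …NestedSheetPencil is the merging `c_k + d_k`).
PROOF = the three-petal proof of …NestedSheetPencil verbatim with the six-petal data: `LA⁶(m_t) = t·Λ(t)`, `Λ(t) = β₆ + (M₆ − 2β₆)t + L₃t²`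
(`nested6_LA_expand`, `nested_LA_star`, `nested_LA_pc`), `β₆ = −w₀X + P₀⁶` (`nested6_beta_eq`), `M₆ = T₆ + u₀X − w₀AG_P` (`nested6_T_eq`),
`L₃ = −N₆ ≤ 0` (`nested6_L3_eq`), `Λ(1) = u₀AG_P ≥ 0`, `(u₀+w₀)²Λ(t*) = u₀(u₀P₀⁶ + w₀T₆) ≥ 0` at the crossing, concavity (`concave_quad_between`);
the B-side is the A-side of the dual data `(g,u,v,t,c,d) ↦ (v,u,g,1−t,d,c)`.
-/

namespace Summit.CriticalPhenomena.PercolationContinuityZ3.Theorems.SunflowerPartition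

namespace NestedSheetPencil

section Pencil

variable {g₁ g₂ g₃ u₁ u₂ u₃ v₁ v₂ v₃ t a b c₁ c₂ c₃ d₁ d₂ d₃ as bs cs₁ cs₂ cs₃ ap bp cp₁ cp₂ cp₃ : ℝ}

set_option maxHeartbeats 400000 in
/-- **(C1)⁶, A-side, on the six-petal nested pencil**: `a ≥ b ⟹ e₃(c,d) ≤ a·(ab − e₂(c,d))`. [this work] -/
theorem nested6_LA_nonneg (hg₁ : 0 ≤ g₁) (hg₂ : 0 ≤ g₂) (hg₃ : 0 ≤ g₃) (hu₁ : 0 ≤ u₁) (hu₂ : 0 ≤ u₂) (hu₃ : 0 ≤ u₃)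
    (hv₁ : 0 ≤ v₁) (hv₂ : 0 ≤ v₂) (hv₃ : 0 ≤ v₃) (ht : 0 ≤ t) (ht' : t ≤ 1)
    (has : as = g₁*g₂*g₃) (hcs₁ : cs₁ = g₂*g₃*(u₁+v₁)) (hcs₂ : cs₂ = g₁*g₃*(u₂+v₂)) (hcs₃ : cs₃ = g₁*g₂*(u₃+v₃))
    (hbs : bs = (g₁+u₁+v₁)*(g₂+u₂+v₂)*(g₃+u₃+v₃) - g₁*g₂*g₃ - g₂*g₃*(u₁+v₁) - g₁*g₃*(u₂+v₂) - g₁*g₂*(u₃+v₃))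
    (hbp : bp = v₁*v₂*v₃) (hcp₁ : cp₁ = (g₁+u₁)*v₂*v₃) (hcp₂ : cp₂ = (g₂+u₂)*v₁*v₃) (hcp₃ : cp₃ = (g₃+u₃)*v₁*v₂)
    (hap : ap = (g₁+u₁+v₁)*(g₂+u₂+v₂)*(g₃+u₃+v₃) - v₁*v₂*v₃ - (g₁+u₁)*v₂*v₃ - (g₂+u₂)*v₁*v₃ - (g₃+u₃)*v₁*v₂)
    (hb : b = (1-t)*bs + t*bp) (hc₁ : c₁ = (1-t)*cs₁) (hc₂ : c₂ = (1-t)*cs₂) (hc₃ : c₃ = (1-t)*cs₃)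
    (hd₁ : d₁ = t*cp₁) (hd₂ : d₂ = t*cp₂) (hd₃ : d₃ = t*cp₃) (ha : a = (1-t)*as + t*ap) (hab : b ≤ a) :
    (c₁*c₂*c₃ + c₁*c₂*d₁ + c₁*c₂*d₂ + c₁*c₂*d₃ + c₁*c₃*d₁ + c₁*c₃*d₂ + c₁*c₃*d₃ + c₁*d₁*d₂ + c₁*d₁*d₃ + c₁*d₂*d₃ + c₂*c₃*d₁ + c₂*c₃*d₂ + c₂*c₃*d₃ + c₂*d₁*d₂ + c₂*d₁*d₃ + c₂*d₂*d₃ + c₃*d₁*d₂ + c₃*d₁*d₃ + c₃*d₂*d₃ + d₁*d₂*d₃) ≤ a*(a*b - (c₁*c₂ + c₁*c₃ + c₁*d₁ + c₁*d₂ + c₁*d₃ + c₂*c₃ + c₂*d₁ + c₂*d₂ + c₂*d₃ + c₃*d₁ + c₃*d₂ + c₃*d₃ + d₁*d₂ + d₁*d₃ + d₂*d₃)) := by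
  -- abstract names and the certificate pieces
  obtain ⟨β, hβ⟩ : ∃ x : ℝ, x = ap*(2*as*bs - (cs₁*cs₂+cs₁*cs₃+cs₂*cs₃)) + bp*as^2 - (cp₁+cp₂+cp₃)*(as*(cs₁+cs₂+cs₃) + (cs₁*cs₂+cs₁*cs₃+cs₂*cs₃)) := ⟨_, rfl⟩
  obtain ⟨M, hM⟩ : ∃ x : ℝ, x = as*(2*ap*bp - (cp₁*cp₂+cp₁*cp₃+cp₂*cp₃)) + bs*ap^2 - (cs₁+cs₂+cs₃)*(ap*(cp₁+cp₂+cp₃) + (cp₁*cp₂+cp₁*cp₃+cp₂*cp₃)) := ⟨_, rfl⟩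
  obtain ⟨AGp, hAGp⟩ : ∃ x : ℝ, x = (ap*bp - (cp₁*cp₂+cp₁*cp₃+cp₂*cp₃)) := ⟨_, rfl⟩
  obtain ⟨X, hX⟩ : ∃ x : ℝ, x = as * ((g₁+u₁+v₁)*(g₂+u₂+v₂)*(g₃+u₃+v₃) - ap) := ⟨_, rfl⟩
  have hE := nested6_LA_expand (as := as) (bs := bs) (cs₁ := cs₁) (cs₂ := cs₂) (cs₃ := cs₃) (ap := ap) (bp := bp) (cp₁ := cp₁)
    (cp₂ := cp₂) (cp₃ := cp₃) hb hc₁ hc₂ hc₃ hd₁ hd₂ hd₃ ha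
  have h0 := nested_LA_star has hcs₁ hcs₂ hcs₃ hbs hbp hcp₁ hcp₂ hcp₃ hap
  have hAG := nested_AG_pc has hcs₁ hcs₂ hcs₃ hbs hbp hcp₁ hcp₂ hcp₃ hap
  have h1 := nested_LA_pc has hcs₁ hcs₂ hcs₃ hbs hbp hcp₁ hcp₂ hcp₃ hap
  obtain ⟨P₀, hP₀0, hF4⟩ := nested6_beta_eq hg₁ hg₂ hg₃ hu₁ hu₂ hu₃ hv₁ hv₂ hv₃ has hcs₁ hcs₂ hcs₃ hbs hbp hcp₁ hcp₂ hcp₃ hap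
  obtain ⟨T, hT0, hF5⟩ := nested6_T_eq hg₁ hg₂ hg₃ hu₁ hu₂ hu₃ hv₁ hv₂ hv₃ has hcs₁ hcs₂ hcs₃ hbs hbp hcp₁ hcp₂ hcp₃ hap
  obtain ⟨D, hD0, hF3⟩ := nested6_L3_eq hg₁ hg₂ hg₃ hu₁ hu₂ hu₃ hv₁ hv₂ hv₃ has hcs₁ hcs₂ hcs₃ hbs hbp hcp₁ hcp₂ hcp₃ hap
  rw [← hβ] at hE hF4 hF3
  rw [← hM] at hE hF5 hF3
  rw [← hAGp] at h1 hF5 hF3 hAG hE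
  rw [← hX] at hF4 hF5
  have hAGp0 : 0 ≤ AGp := by rw [hAG]; positivity
  have hX0 : 0 ≤ X := by
    rw [hX]
    have has0 : 0 ≤ as := by rw [has]; positivity
    have : (g₁+u₁+v₁)*(g₂+u₂+v₂)*(g₃+u₃+v₃) - ap = bp + cp₁ + cp₂ + cp₃ := by rw [hap, hbp, hcp₁, hcp₂, hcp₃]; ring
    rw [this, hbp, hcp₁, hcp₂, hcp₃]; positivity
  clear hX hAG hβ hM hAGp
  -- a − b along the pencil: −w₀ + t·(u₀ + w₀), w₀ = b* − a*, u₀ = a_P − b_P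
  obtain ⟨w₀, hw₀⟩ : ∃ x : ℝ, x = bs - as := ⟨_, rfl⟩
  obtain ⟨u₀, hu₀⟩ : ∃ x : ℝ, x = ap - bp := ⟨_, rfl⟩
  have hab' : w₀ ≤ t * (u₀ + w₀) := by rw [hw₀, hu₀]; rw [ha, hb] at hab; linarith
  rw [← hu₀] at h1 hF5 hF3
  have hS : 0 ≤ u₀ + w₀ := by
    have e : u₀ + w₀ = g₁*g₂*u₃ + g₁*g₂*v₃ + g₁*g₃*u₂ + g₁*g₃*v₂ + 2*g₁*u₂*u₃ + 2*g₁*u₂*v₃ + 2*g₁*u₃*v₂ + g₁*v₂*v₃ + g₂*g₃*u₁ + g₂*g₃*v₁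
        + 2*g₂*u₁*u₃ + 2*g₂*u₁*v₃ + 2*g₂*u₃*v₁ + g₂*v₁*v₃ + 2*g₃*u₁*u₂ + 2*g₃*u₁*v₂ + 2*g₃*u₂*v₁ + g₃*v₁*v₂ + 2*u₁*u₂*u₃ + 2*u₁*u₂*v₃
        + 2*u₁*u₃*v₂ + u₁*v₂*v₃ + 2*u₂*u₃*v₁ + u₂*v₁*v₃ + u₃*v₁*v₂ := by
      rw [hu₀, hw₀, hap, hbp, hbs, has]; ring
    rw [e]; positivity
  have hw₀' : as - bs = -w₀ := by rw [hw₀]; ring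
  have hw₀'' : bs - as = w₀ := by rw [hw₀]
  rw [hw₀'] at hF4; rw [hw₀''] at hF5
  -- LA⁶(m_t) = t·Λ(t), Λ(t) = β + (M − 2β)t + L₃t²
  obtain ⟨L₃, hL₃⟩ : ∃ x : ℝ, x = β - M + u₀ * AGp := ⟨_, rfl⟩
  have hLA : a*(a*b - (c₁*c₂ + c₁*c₃ + c₁*d₁ + c₁*d₂ + c₁*d₃ + c₂*c₃ + c₂*d₁ + c₂*d₂ + c₂*d₃ + c₃*d₁ + c₃*d₂ + c₃*d₃ + d₁*d₂ + d₁*d₃ + d₂*d₃)) - (c₁*c₂*c₃ + c₁*c₂*d₁ + c₁*c₂*d₂ + c₁*c₂*d₃ + c₁*c₃*d₁ + c₁*c₃*d₂ + c₁*c₃*d₃ + c₁*d₁*d₂ + c₁*d₁*d₃ + c₁*d₂*d₃ + c₂*c₃*d₁ + c₂*c₃*d₂ + c₂*c₃*d₃ + c₂*d₁*d₂ + c₂*d₁*d₃ + c₂*d₂*d₃ + c₃*d₁*d₂ + c₃*d₁*d₃ + c₃*d₂*d₃ + d₁*d₂*d₃) = t * (β + (M - 2*β) * t + L₃ * t ^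 2) := by
    rw [hE, h0, h1, hL₃]; ring
  have hL₃0 : L₃ ≤ 0 := by
    rw [hL₃, hF3, neg_nonpos]; exact hD0
  rw [← sub_nonneg, hLA]
  clear hE h0 h1 hLA ha hb hc₁ hc₂ hc₃ hd₁ hd₂ hd₃ has hbs hcs₁ hcs₂ hcs₃ hap hbp hcp₁ hcp₂ hcp₃ hab
  have hu₀0 : 0 ≤ u₀ := by
    have hle : t * (u₀ + w₀) ≤ u₀ + w₀ := mul_le_of_le_one_left hS ht'
    linarith
  -- Λ(1) = u₀·AG_P ≥ 0
  have hΛ1 : 0 ≤ β + (M - 2*β) * 1 + L₃ * 1 ^ 2 := by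
    have e : β + (M - 2*β) * 1 + L₃ * 1 ^ 2 = u₀ * AGp := by rw [hL₃]; ring
    rw [e]; exact mul_nonneg hu₀0 hAGp0
  suffices hΛ : 0 ≤ β + (M - 2*β) * t + L₃ * t ^ 2 from mul_nonneg ht hΛ
  by_cases hw0 : w₀ ≤ 0
  · -- `a* ≥ b*`: Λ(0) = β ≥ 0; interpolate between 0 and 1
    have hΛ0 : 0 ≤ β + (M - 2*β) * 0 + L₃ * 0 ^ 2 := by
      have e : β + (M - 2*β) * 0 + L₃ * 0 ^ 2 = -w₀ * X + P₀ := by rw [hF4]; ring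
      rw [e]; nlinarith [mul_nonneg (neg_nonneg.2 hw0) hX0]
    exact concave_quad_between hL₃0 ht ht' (by simpa using hΛ0) (by simpa using hΛ1)
  · -- interior crossing `t* = w₀/(u₀+w₀) ∈ (0, t]`
    push Not at hw0
    have hSpos : 0 < u₀ + w₀ := by linarith
    obtain ⟨ts, hts⟩ : ∃ x : ℝ, x = w₀ / (u₀ + w₀) := ⟨_, rfl⟩
    have hts0 : 0 ≤ ts := by rw [hts]; exact div_nonneg hw0.le hSpos.le
    have htst : ts ≤ t := by rw [hts, div_le_iff₀ hSpos]; linarith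
    have hΛts : 0 ≤ β + (M - 2*β) * ts + L₃ * ts ^ 2 := by
      have e : β + (M - 2*β) * ts + L₃ * ts ^ 2 =
          ((u₀ + w₀) ^ 2 * β + (u₀ + w₀) * (M - 2*β) * w₀ + L₃ * w₀ ^ 2) / (u₀ + w₀) ^ 2 := by
        rw [hts]; field_simp
      have hc : (u₀ + w₀) ^ 2 * β + (u₀ + w₀) * (M - 2*β) * w₀ + L₃ * w₀ ^ 2 = u₀ * (u₀ * P₀ + w₀ * T) := by
        rw [hL₃, hF4, hF5]; ring
      rw [e, hc]
      apply div_nonneg _ (sq_nonneg _)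
      exact mul_nonneg hu₀0 (by nlinarith [mul_nonneg hu₀0 hP₀0, mul_nonneg hw0.le hT0])
    exact concave_quad_between hL₃0 htst ht' hΛts (by simpa using hΛ1)

/-- **(C1)⁶, B-side**: `a ≤ b ⟹ e₃(c,d) ≤ b·(ab − e₂(c,d))` — the A-side for the dual data `(g,u,v,t,c,d) ↦ (v,u,g,1−t,d,c)`. [this work] -/
theorem nested6_LB_nonneg (hg₁ : 0 ≤ g₁) (hg₂ : 0 ≤ g₂) (hg₃ : 0 ≤ g₃) (hu₁ : 0 ≤ u₁) (hu₂ : 0 ≤ u₂) (hu₃ : 0 ≤ u₃)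
    (hv₁ : 0 ≤ v₁) (hv₂ : 0 ≤ v₂) (hv₃ : 0 ≤ v₃) (ht : 0 ≤ t) (ht' : t ≤ 1)
    (has : as = g₁*g₂*g₃) (hcs₁ : cs₁ = g₂*g₃*(u₁+v₁)) (hcs₂ : cs₂ = g₁*g₃*(u₂+v₂)) (hcs₃ : cs₃ = g₁*g₂*(u₃+v₃))
    (hbs : bs = (g₁+u₁+v₁)*(g₂+u₂+v₂)*(g₃+u₃+v₃) - g₁*g₂*g₃ - g₂*g₃*(u₁+v₁) - g₁*g₃*(u₂+v₂) - g₁*g₂*(u₃+v₃))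
    (hbp : bp = v₁*v₂*v₃) (hcp₁ : cp₁ = (g₁+u₁)*v₂*v₃) (hcp₂ : cp₂ = (g₂+u₂)*v₁*v₃) (hcp₃ : cp₃ = (g₃+u₃)*v₁*v₂)
    (hap : ap = (g₁+u₁+v₁)*(g₂+u₂+v₂)*(g₃+u₃+v₃) - v₁*v₂*v₃ - (g₁+u₁)*v₂*v₃ - (g₂+u₂)*v₁*v₃ - (g₃+u₃)*v₁*v₂)
    (hb : b = (1-t)*bs + t*bp) (hc₁ : c₁ = (1-t)*cs₁) (hc₂ : c₂ = (1-t)*cs₂) (hc₃ : c₃ = (1-t)*cs₃)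
    (hd₁ : d₁ = t*cp₁) (hd₂ : d₂ = t*cp₂) (hd₃ : d₃ = t*cp₃) (ha : a = (1-t)*as + t*ap) (hba : a ≤ b) :
    (c₁*c₂*c₃ + c₁*c₂*d₁ + c₁*c₂*d₂ + c₁*c₂*d₃ + c₁*c₃*d₁ + c₁*c₃*d₂ + c₁*c₃*d₃ + c₁*d₁*d₂ + c₁*d₁*d₃ + c₁*d₂*d₃ + c₂*c₃*d₁ + c₂*c₃*d₂ + c₂*c₃*d₃ + c₂*d₁*d₂ + c₂*d₁*d₃ + c₂*d₂*d₃ + c₃*d₁*d₂ + c₃*d₁*d₃ + c₃*d₂*d₃ + d₁*d₂*d₃) ≤ b*(a*b - (c₁*c₂ + c₁*c₃ + c₁*d₁ + c₁*d₂ + c₁*d₃ + c₂*c₃ + c₂*d₁ + c₂*d₂ + c₂*d₃ + c₃*d₁ + c₃*d₂ + c₃*d₃ + d₁*d₂ + d₁*d₃ + d₂*d₃)) := by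
  have h := nested6_LA_nonneg (g₁ := v₁) (g₂ := v₂) (g₃ := v₃) (u₁ := u₁) (u₂ := u₂) (u₃ := u₃) (v₁ := g₁) (v₂ := g₂) (v₃ := g₃)
    (t := 1 - t) (a := b) (b := a) (c₁ := d₁) (c₂ := d₂) (c₃ := d₃) (d₁ := c₁) (d₂ := c₂) (d₃ := c₃)
    (as := bp) (bs := ap) (cs₁ := cp₁) (cs₂ := cp₂) (cs₃ := cp₃) (ap := bs) (bp := as) (cp₁ := cs₁) (cp₂ := cs₂) (cp₃ := cs₃)
    hv₁ hv₂ hv₃ hu₁ hu₂ hu₃ hg₁ hg₂ hg₃ (by linarith) (by linarith)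
    hbp (by rw [hcp₁]; ring) (by rw [hcp₂]; ring) (by rw [hcp₃]; ring) (by rw [hap]; ring)
    has (by rw [hcs₁]; ring) (by rw [hcs₂]; ring) (by rw [hcs₃]; ring) (by rw [hbs]; ring)
    (by rw [ha]; ring) (by rw [hd₁]; ring) (by rw [hd₂]; ring) (by rw [hd₃]; ring) hc₁ hc₂ hc₃
    (by rw [hb]; ring) hba
  have e3 : (d₁*d₂*d₃ + d₁*d₂*c₁ + d₁*d₂*c₂ + d₁*d₂*c₃ + d₁*d₃*c₁ + d₁*d₃*c₂ + d₁*d₃*c₃ + d₁*c₁*c₂ + d₁*c₁*c₃ + d₁*c₂*c₃ + d₂*d₃*c₁ + d₂*d₃*c₂ + d₂*d₃*c₃ + d₂*c₁*c₂ + d₂*c₁*c₃ + d₂*c₂*c₃ + d₃*c₁*c₂ + d₃*c₁*c₃ + d₃*c₂*c₃ + c₁*c₂*c₃) = (c₁*c₂*c₃ + c₁*c₂*d₁ + c₁*c₂*d₂ + c₁*c₂*d₃ + c₁*c₃*d₁ + c₁*c₃*d₂ + c₁*c₃*d₃ + c₁*d₁*d₂ + c₁*d₁*d₃ + c₁*d₂*d₃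 + c₂*c₃*d₁ + c₂*c₃*d₂ + c₂*c₃*d₃ + c₂*d₁*d₂ + c₂*d₁*d₃ + c₂*d₂*d₃ + c₃*d₁*d₂ + c₃*d₁*d₃ + c₃*d₂*d₃ + d₁*d₂*d₃) := by ring
  have e2 : b * (b * a - (d₁*d₂ + d₁*d₃ + d₁*c₁ + d₁*c₂ + d₁*c₃ + d₂*d₃ + d₂*c₁ + d₂*c₂ + d₂*c₃ + d₃*c₁ + d₃*c₂ + d₃*c₃ + c₁*c₂ + c₁*c₃ + c₂*c₃)) = b*(a*b - (c₁*c₂ + c₁*c₃ + c₁*d₁ + c₁*d₂ + c₁*d₃ + c₂*c₃ + c₂*d₁ + c₂*d₂ + c₂*d₃ + c₃*d₁ + c₃*d₂ + c₃*d₃ + d₁*d₂ + d₁*d₃ + d₂*d₃)) := by ring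
  rw [e3, e2] at h; exact h

/-- **THEOREM ((C1) on the six-petal nested pencil).**  For `g,u,v ≥ 0` and `t ∈ [0,1]`, the six-petal law (bottom `(1−t)b* + tb_P`, lower petals
`(1−t)c*_k`, upper petals `t·c_{P,k}`, core `(1−t)a* + t a_P`) satisfies `e₃(c,d) ≤ max(a,b)·(ab − e₂(c,d))`; hence (C1) for
`[z=0: PC*(G); z=1: PC(W)]` under every merging of the six petals into three. [this work] -/
theorem nestedSix_C1 (hg₁ : 0 ≤ g₁) (hg₂ : 0 ≤ g₂) (hg₃ : 0 ≤ g₃) (hu₁ : 0 ≤ u₁) (hu₂ : 0 ≤ u₂) (hu₃ : 0 ≤ u₃)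
    (hv₁ : 0 ≤ v₁) (hv₂ : 0 ≤ v₂) (hv₃ : 0 ≤ v₃) (ht : 0 ≤ t) (ht' : t ≤ 1)
    (has : as = g₁*g₂*g₃) (hcs₁ : cs₁ = g₂*g₃*(u₁+v₁)) (hcs₂ : cs₂ = g₁*g₃*(u₂+v₂)) (hcs₃ : cs₃ = g₁*g₂*(u₃+v₃))
    (hbs : bs = (g₁+u₁+v₁)*(g₂+u₂+v₂)*(g₃+u₃+v₃) - g₁*g₂*g₃ - g₂*g₃*(u₁+v₁) - g₁*g₃*(u₂+v₂) - g₁*g₂*(u₃+v₃))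
    (hbp : bp = v₁*v₂*v₃) (hcp₁ : cp₁ = (g₁+u₁)*v₂*v₃) (hcp₂ : cp₂ = (g₂+u₂)*v₁*v₃) (hcp₃ : cp₃ = (g₃+u₃)*v₁*v₂)
    (hap : ap = (g₁+u₁+v₁)*(g₂+u₂+v₂)*(g₃+u₃+v₃) - v₁*v₂*v₃ - (g₁+u₁)*v₂*v₃ - (g₂+u₂)*v₁*v₃ - (g₃+u₃)*v₁*v₂)
    (hb : b = (1-t)*bs + t*bp) (hc₁ : c₁ = (1-t)*cs₁) (hc₂ : c₂ = (1-t)*cs₂) (hc₃ : c₃ = (1-t)*cs₃)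
    (hd₁ : d₁ = t*cp₁) (hd₂ : d₂ = t*cp₂) (hd₃ : d₃ = t*cp₃) (ha : a = (1-t)*as + t*ap) :
    (c₁*c₂*c₃ + c₁*c₂*d₁ + c₁*c₂*d₂ + c₁*c₂*d₃ + c₁*c₃*d₁ + c₁*c₃*d₂ + c₁*c₃*d₃ + c₁*d₁*d₂ + c₁*d₁*d₃ + c₁*d₂*d₃ + c₂*c₃*d₁ + c₂*c₃*d₂ + c₂*c₃*d₃ + c₂*d₁*d₂ + c₂*d₁*d₃ + c₂*d₂*d₃ + c₃*d₁*d₂ + c₃*d₁*d₃ + c₃*d₂*d₃ + d₁*d₂*d₃) ≤ max a b * (a*b - (c₁*c₂ + c₁*c₃ + c₁*d₁ + c₁*d₂ + c₁*d₃ + c₂*c₃ + c₂*d₁ + c₂*d₂ + c₂*d₃ + c₃*d₁ + c₃*d₂ + c₃*d₃ + d₁*d₂ + d₁*d₃ + d₂*d₃)) := by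
  rcases le_total b a with hab | hba
  · rw [max_eq_left hab]
    exact nested6_LA_nonneg hg₁ hg₂ hg₃ hu₁ hu₂ hu₃ hv₁ hv₂ hv₃ ht ht' has hcs₁ hcs₂ hcs₃ hbs hbp hcp₁ hcp₂ hcp₃ hap hb hc₁ hc₂ hc₃ hd₁ hd₂ hd₃ ha hab
  · rw [max_eq_right hba]
    exact nested6_LB_nonneg hg₁ hg₂ hg₃ hu₁ hu₂ hu₃ hv₁ hv₂ hv₃ ht ht' has hcs₁ hcs₂ hcs₃ hbs hbp hcp₁ hcp₂ hcp₃ hap hb hc₁ hc₂ hc₃ hd₁ hd₂ hd₃ ha hba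

end Pencil

end NestedSheetPencil

end Summit.CriticalPhenomena.PercolationContinuityZ3.Theorems.SunflowerPartition
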